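import Summits.CriticalPhenomena.PercolationContinuityZ3.Theorems.PercNonProliferationSubpolynomialBlockingStubUpperSandwich
import HarnessLib

/-!
# Crux `PercNonProliferation.SubpolynomialBlocking` (stmt-CriticalPhenomena-4446), line `cross-sandwich-flat-seal` — stub `stub_cruxImpliesAnchor`

Helper file for the crux skeleton `Cruxes/SubpolynomialBlocking/Lines/cross-sandwich-flat-seal.lean`
(lead prover-line-stmt-CriticalPhenomena-4446-0). Proves exactly the registered stub signature
`stub_cruxImpliesAnchor`; lands with `--supports stmt-CriticalPhenomena-4446`.

## The statement (NECESSITY OF THE ANCHOR, certified)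

If the crux holds — the critical annulus-blocking probability `u_n = P_{p_c}(Λ_n ↮ ∂ⁱⁿΛ_{2n} in Λ_{2n})`
is `≥ n^{-s}` eventually for every `s > 0` — then so is the critical CUBE-SEALING probability
`q_n = P_{p_c}(no open path inside [0,n]³ from the face {x₀ = 0} to the face {x₀ = n})`:
`∀ s > 0, ∀ᶠ n, n^{-s} ≤ q_n` (the line's `CubeSealSubpoly`, written out). Hence any refutation of the
anchor — rigorous or numerical — refutes the crux; the anchor cannot be "the wrong cut".

## The argument

`n^{-6s} ≤ u_n` eventually (the crux at exponent `6s`) and `u_n ≤ q_n⁶` for `n ≥ 2` (the landed upper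
sandwich `stub_upperSandwich`: six pairwise vertex-disjoint cubes in the shell, independence, symmetry);
take sixth roots (`le_of_pow_le_pow_left₀`). The crux is read through `Negative.crux_iff` /
`Negative.subpolynomialBlockingAt_iff` (both `Iff.rfl`) as a statement about `Negative.blockProb 3 p_c n`.
-/

noncomputable section

namespace Summit.CriticalPhenomena.PercolationContinuityZ3.Theorems.SubpolynomialBlocking

open MeasureTheory Filter Topology
open Literature.Probability.Percolation Literature.Probability.LatticeModels
open Summit.CriticalPhenomena.PercolationContinuityZ3.Theorems.SubpolynomialBlocking.Negative

/-- **Registered stub `stub_cruxImpliesAnchor`** (crux stmt-CriticalPhenomena-4446, line `cross-sandwich-flat-seal`):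
the crux `SubpolynomialBlocking` implies that the critical cube seal is sub-polynomial,
`∀ s > 0, ∀ᶠ n, n^{-s} ≤ P_{p_c}([0,n]³ sealed between {x₀ = 0} and {x₀ = n})` — from `n^{-6s} ≤ u_n ≤ q_n⁶`
(`stub_upperSandwich`). -/
theorem stub_cruxImpliesAnchor :
    Summit.CriticalPhenomena.PercolationContinuityZ3.Theses.PercNonProliferation.SubpolynomialBlocking →
      ∀ s : ℝ, 0 < s → ∀ᶠ n : ℕ in atTop,
        (n : ℝ) ^ (-s) ≤
          (bondPercolation (zdGraph 3) (criticalProbI 3)).real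
            (openCrossing (Set.Icc (0 : Site 3) ![(n : ℤ), (n : ℤ), (n : ℤ)])
              {x | x ∈ Set.Icc (0 : Site 3) ![(n : ℤ), (n : ℤ), (n : ℤ)] ∧ x 0 = 0}
              {y | y ∈ Set.Icc (0 : Site 3) ![(n : ℤ), (n : ℤ), (n : ℤ)] ∧ y 0 = (n : ℤ)})ᶜ := by
  intro h s hs
  have h6 := (crux_iff.mp h) (6 * s) (by positivity)
  filter_upwards [h6, eventually_ge_atTop 2] with n h1 hn
  have hn0 : (0 : ℝ) ≤ n := Nat.cast_nonneg n
  have hq : 0 ≤ (bondPercolation (zdGraph 3) (criticalProbI 3)).real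
      (openCrossing (Set.Icc (0 : Site 3) ![(n : ℤ), (n : ℤ), (n : ℤ)])
        {x | x ∈ Set.Icc (0 : Site 3) ![(n : ℤ), (n : ℤ), (n : ℤ)] ∧ x 0 = 0}
        {y | y ∈ Set.Icc (0 : Site 3) ![(n : ℤ), (n : ℤ), (n : ℤ)] ∧ y 0 = (n : ℤ)})ᶜ := measureReal_nonneg
  have key : ((n : ℝ) ^ (-s)) ^ 6 ≤ (bondPercolation (zdGraph 3) (criticalProbI 3)).real
      (openCrossing (Set.Icc (0 : Site 3) ![(n : ℤ), (n : ℤ), (n : ℤ)])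
        {x | x ∈ Set.Icc (0 : Site 3) ![(n : ℤ), (n : ℤ), (n : ℤ)] ∧ x 0 = 0}
        {y | y ∈ Set.Icc (0 : Site 3) ![(n : ℤ), (n : ℤ), (n : ℤ)] ∧ y 0 = (n : ℤ)})ᶜ ^ 6 := by
    calc ((n : ℝ) ^ (-s)) ^ 6 = (n : ℝ) ^ (-(6 * s)) := by
          rw [← Real.rpow_natCast, ← Real.rpow_mul hn0]; ring_nf
      _ ≤ blockProb 3 (criticalProbI 3) n := h1
      _ ≤ _ := stub_upperSandwich n hn
  exact le_of_pow_le_pow_left₀ (by norm_num) hq key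

end Summit.CriticalPhenomena.PercolationContinuityZ3.Theorems.SubpolynomialBlocking

end
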